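import Literature.MathematicalPhysics.QuantumManyBody.TorusFockLayer
import Literature.MathematicalPhysics.QuantumManyBody.DiluteBoseGasUpperBoundLocalization
import Mathlib.MeasureTheory.Function.Floor
import Summits.AtomisticToContinuum.BoseEinsteinCondensation.Theorems.BlockLatticeFSumPlancherel

/-!
# Block-mode kinematics for route `BlockLatticeFSum` (decomp-a2c lens-6 g22)

Measure-theoretic bridge between `cellOccupation` (an `ℝ≥0∞` integral over the slice variable
`Y ∈ cellⁿ` of `|a(φ)Ψ(Y)|²`, `TorusFockLayer.cellOccupation_eq_lintegral_modeAn`) and the finite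
lattice algebra of the route's engine (`BlockLatticeFSumEngine{Char,Bond}`):

* `measurable_modeAn` — `Y ↦ a(φ)Ψ(Y)` is measurable for a measurable mode and continuous `Ψ`;
* `modeAn_finset_sum_mode` / `modeAn_const_mul_mode` / `modeAn_add_mode` / `modeAn_sub_mode` —
  conjugate-linearity of `a(·)` in the MODE (bounded measurable modes: finite sums, bond modes
  `(u_B ± u_B')/√2`, super-block modes `Σ_(B ⊂ S) u_B/√8`);
* `cellOccupation_congr` — the occupation only sees the mode on the cell;
* `cellOccupation_transfer_eq/le` — a POINTWISE (in `Y`) identity / inequality between weighted sums of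
  `|a(φ)Ψ(Y)|²` integrates to the same identity / inequality between weighted sums of occupations;
* the block indicators `u_B` and block plane waves `f_q` of the route decls (verbatim lambdas, no defs):
  measurability, bound, the cell expansion `f_q = Σ_B K^{-3/2} χ_q(B) u_B`, the Gram form of `n(f_q)`,
  and PARSEVAL `Σ_q n(f_q) = Σ_B n(u_B)` — first from the finite Plancherel identity as a hypothesis,
  then unconditionally (`parseval_blockWaves'`, `parseval_blockWaves_trialState`) via
  `Theorems/BlockLatticeFSumPlancherel.lean`.

Imports: `Literature.…TorusFockLayer`, `Mathlib.MeasureTheory.Function.Floor`, and the sibling helper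
`Theorems/BlockLatticeFSumPlancherel.lean` (Mathlib only); no `sorry`; no new definitions.
-/

noncomputable section

open MeasureTheory Complex
open scoped ENNReal NNReal ComplexConjugate BigOperators
open Literature.MathematicalPhysics.QuantumManyBody.BoseGas

namespace Summit.AtomisticToContinuum.BoseEinsteinCondensation.Theses.BlockLatticeFSum.Kinematics

variable {L : ℝ} {n : ℕ}

/-! ## 1. The slice amplitude `a(φ)Ψ` : measurability and conjugate-linearity in the mode -/

/-- `Y ↦ a(φ)Ψ(Y)` is measurable for a measurable mode `φ` and a continuous `Ψ`. -/
theorem measurable_modeAn {φ : Space → ℂ} (hφ : Measurable φ) {Ψ : Config (n + 1) → ℂ}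
    (hΨ : Continuous Ψ) : Measurable fun Y : Config n => modeAn L φ Ψ Y := by
  have h : StronglyMeasurable (Function.uncurry fun (Y : Config n) (x : Space) =>
      conj (φ x) * Ψ (Matrix.vecCons x Y)) := by
    refine Measurable.stronglyMeasurable ?_
    refine (Complex.continuous_conj.measurable.comp (hφ.comp measurable_snd)).mul
      (hΨ.measurable.comp ?_)
    exact (continuous_snd.matrixVecCons continuous_fst).measurable
  have h2 : StronglyMeasurable fun Y : Config n =>
      ∫ x in cell L, conj (φ x) * Ψ (Matrix.vecCons x Y) :=
    h.integral_prod_right' (ν := volume.restrict (cell L))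
  simp only [modeAn_apply]
  exact measurable_const.mul h2.measurable

/-- `a(Σᵢ cᵢ φᵢ)Ψ = Σᵢ conj(cᵢ) a(φᵢ)Ψ` for bounded measurable modes and continuous `Ψ`. -/
theorem modeAn_finset_sum_mode {ι : Type*} (s : Finset ι) (c : ι → ℂ) (φ : ι → Space → ℂ)
    (hφ : ∀ i, Measurable (φ i)) (hb : ∀ i, ∃ C : ℝ, ∀ x, ‖φ i x‖ ≤ C)
    {Ψ : Config (n + 1) → ℂ} (hΨ : Continuous Ψ) (Y : Config n) :
    modeAn L (fun x => ∑ i ∈ s, c i * φ i x) Ψ Y = ∑ i ∈ s, conj (c i) * modeAn L (φ i) Ψ Y := by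
  simp only [modeAn_apply]
  have hslice : Continuous fun x : Space => Ψ (Matrix.vecCons x Y) :=
    hΨ.comp (continuous_id.matrixVecCons continuous_const)
  have hint : ∀ i ∈ s, IntegrableOn
      (fun x => conj (c i) * (conj (φ i x) * Ψ (Matrix.vecCons x Y))) (cell L) := by
    intro i _
    obtain ⟨C, hC⟩ := hb i
    exact (integrableOn_cell_conj_mul (hφ i) hC hslice).const_mul _
  have hpt : (fun x => conj (∑ i ∈ s, c i * φ i x) * Ψ (Matrix.vecCons x Y)) =
      fun x => ∑ i ∈ s, conj (c i) * (conj (φ i x) * Ψ (Matrix.vecCons x Y)) := by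
    funext x
    rw [map_sum, Finset.sum_mul]
    refine Finset.sum_congr rfl fun i _ => ?_
    rw [map_mul]; ring
  rw [hpt, integral_finsetSum s hint, Finset.mul_sum]
  refine Finset.sum_congr rfl fun i _ => ?_
  rw [integral_const_mul]
  ring

/-- `a(c φ)Ψ = conj(c) a(φ)Ψ` (no integrability needed). -/
theorem modeAn_const_mul_mode (c : ℂ) (φ : Space → ℂ) (Ψ : Config (n + 1) → ℂ) (Y : Config n) :
    modeAn L (fun x => c * φ x) Ψ Y = conj c * modeAn L φ Ψ Y := by
  simp only [modeAn_apply]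
  have : (fun x => conj (c * φ x) * Ψ (Matrix.vecCons x Y)) =
      fun x => conj c * (conj (φ x) * Ψ (Matrix.vecCons x Y)) := by
    funext x; rw [map_mul]; ring
  rw [this, integral_const_mul]
  ring

/-- `a(φ₁ + φ₂)Ψ = a(φ₁)Ψ + a(φ₂)Ψ` for bounded measurable modes and continuous `Ψ`. -/
theorem modeAn_add_mode {φ₁ φ₂ : Space → ℂ} (h₁ : Measurable φ₁) (h₂ : Measurable φ₂)
    {C₁ C₂ : ℝ} (hC₁ : ∀ x, ‖φ₁ x‖ ≤ C₁) (hC₂ : ∀ x, ‖φ₂ x‖ ≤ C₂)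
    {Ψ : Config (n + 1) → ℂ} (hΨ : Continuous Ψ) (Y : Config n) :
    modeAn L (fun x => φ₁ x + φ₂ x) Ψ Y = modeAn L φ₁ Ψ Y + modeAn L φ₂ Ψ Y := by
  simp only [modeAn_apply]
  have hslice : Continuous fun x : Space => Ψ (Matrix.vecCons x Y) :=
    hΨ.comp (continuous_id.matrixVecCons continuous_const)
  have : (fun x => conj (φ₁ x + φ₂ x) * Ψ (Matrix.vecCons x Y)) =
      fun x => conj (φ₁ x) * Ψ (Matrix.vecCons x Y) + conj (φ₂ x) * Ψ (Matrix.vecCons x Y) := by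
    funext x; rw [map_add]; ring
  rw [this, integral_add (integrableOn_cell_conj_mul h₁ hC₁ hslice)
    (integrableOn_cell_conj_mul h₂ hC₂ hslice)]
  ring

/-- `a(φ₁ − φ₂)Ψ = a(φ₁)Ψ − a(φ₂)Ψ` for bounded measurable modes and continuous `Ψ`. -/
theorem modeAn_sub_mode {φ₁ φ₂ : Space → ℂ} (h₁ : Measurable φ₁) (h₂ : Measurable φ₂)
    {C₁ C₂ : ℝ} (hC₁ : ∀ x, ‖φ₁ x‖ ≤ C₁) (hC₂ : ∀ x, ‖φ₂ x‖ ≤ C₂)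
    {Ψ : Config (n + 1) → ℂ} (hΨ : Continuous Ψ) (Y : Config n) :
    modeAn L (fun x => φ₁ x - φ₂ x) Ψ Y = modeAn L φ₁ Ψ Y - modeAn L φ₂ Ψ Y := by
  simp only [modeAn_apply]
  have hslice : Continuous fun x : Space => Ψ (Matrix.vecCons x Y) :=
    hΨ.comp (continuous_id.matrixVecCons continuous_const)
  have : (fun x => conj (φ₁ x - φ₂ x) * Ψ (Matrix.vecCons x Y)) =
      fun x => conj (φ₁ x) * Ψ (Matrix.vecCons x Y) - conj (φ₂ x) * Ψ (Matrix.vecCons x Y) := by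
    funext x; rw [map_sub]; ring
  rw [this, integral_sub (integrableOn_cell_conj_mul h₁ hC₁ hslice)
    (integrableOn_cell_conj_mul h₂ hC₂ hslice)]
  ring

/-! ## 2. Occupations: dependence on the cell only, and pointwise-to-integrated transfer -/

/-- The cell occupation only depends on the mode restricted to the cell. -/
theorem cellOccupation_congr {N : ℕ} {φ φ' : Space → ℂ} (h : ∀ x ∈ cell L, φ x = φ' x)
    (Ψ : Config N → ℂ) : cellOccupation N L φ Ψ = cellOccupation N L φ' Ψ := by
  unfold cellOccupation
  rw [Set.indicator_congr (fun x hx => h x hx)]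

/-- TRANSFER (equality): a pointwise identity between weighted sums of squared slice amplitudes of two
finite mode families integrates to the same identity between weighted sums of cell occupations. -/
theorem cellOccupation_transfer_eq {α β : Type*} (s : Finset α) (t : Finset β)
    (w : α → ℝ) (w' : β → ℝ) (hw : ∀ a ∈ s, 0 ≤ w a) (hw' : ∀ b ∈ t, 0 ≤ w' b)
    (g : α → Space → ℂ) (h : β → Space → ℂ) (hg : ∀ a, Measurable (g a)) (hh : ∀ b, Measurable (h b))
    {Ψ : Config (n + 1) → ℂ} (hΨ : Continuous Ψ)
    (hpt : ∀ Y : Config n, Y ∈ cellN n L →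
      ∑ a ∈ s, w a * ‖modeAn L (g a) Ψ Y‖ ^ 2 = ∑ b ∈ t, w' b * ‖modeAn L (h b) Ψ Y‖ ^ 2) :
    ∑ a ∈ s, ENNReal.ofReal (w a) * cellOccupation (n + 1) L (g a) Ψ
      = ∑ b ∈ t, ENNReal.ofReal (w' b) * cellOccupation (n + 1) L (h b) Ψ := by
  simp only [cellOccupation_eq_lintegral_modeAn]
  have hmg : ∀ a ∈ s, Measurable fun Y : Config n =>
      ENNReal.ofReal (w a) * ((‖modeAn L (g a) Ψ Y‖₊ : ℝ≥0∞)) ^ 2 := fun a _ =>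
    ((measurable_modeAn (hg a) hΨ).nnnorm.coe_nnreal_ennreal.pow_const 2).const_mul _
  have hmh : ∀ b ∈ t, Measurable fun Y : Config n =>
      ENNReal.ofReal (w' b) * ((‖modeAn L (h b) Ψ Y‖₊ : ℝ≥0∞)) ^ 2 := fun b _ =>
    ((measurable_modeAn (hh b) hΨ).nnnorm.coe_nnreal_ennreal.pow_const 2).const_mul _
  simp_rw [← lintegral_const_mul' _ _ ENNReal.ofReal_ne_top]
  rw [← lintegral_finsetSum' _ fun a ha => (hmg a ha).aemeasurable,
    ← lintegral_finsetSum' _ fun b hb => (hmh b hb).aemeasurable]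
  refine setLIntegral_congr_fun (measurableSet_cellN n L) (fun Y hY => ?_)
  simp only [Literature.MathematicalPhysics.QuantumManyBody.BoseGas.ennnorm_sq_eq_ofReal]
  rw [← Finset.sum_congr rfl fun a ha => ENNReal.ofReal_mul (hw a ha),
    ← Finset.sum_congr rfl fun b hb => ENNReal.ofReal_mul (hw' b hb),
    ← ENNReal.ofReal_sum_of_nonneg fun a ha => mul_nonneg (hw a ha) (sq_nonneg _),
    ← ENNReal.ofReal_sum_of_nonneg fun b hb => mul_nonneg (hw' b hb) (sq_nonneg _), hpt Y hY]

/-- TRANSFER (inequality): the same for a pointwise inequality. -/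
theorem cellOccupation_transfer_le {α β : Type*} (s : Finset α) (t : Finset β)
    (w : α → ℝ) (w' : β → ℝ) (hw : ∀ a ∈ s, 0 ≤ w a) (hw' : ∀ b ∈ t, 0 ≤ w' b)
    (g : α → Space → ℂ) (h : β → Space → ℂ) (hg : ∀ a, Measurable (g a)) (hh : ∀ b, Measurable (h b))
    {Ψ : Config (n + 1) → ℂ} (hΨ : Continuous Ψ)
    (hpt : ∀ Y : Config n, Y ∈ cellN n L →
      ∑ a ∈ s, w a * ‖modeAn L (g a) Ψ Y‖ ^ 2 ≤ ∑ b ∈ t, w' b * ‖modeAn L (h b) Ψ Y‖ ^ 2) :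
    ∑ a ∈ s, ENNReal.ofReal (w a) * cellOccupation (n + 1) L (g a) Ψ
      ≤ ∑ b ∈ t, ENNReal.ofReal (w' b) * cellOccupation (n + 1) L (h b) Ψ := by
  simp only [cellOccupation_eq_lintegral_modeAn]
  have hmg : ∀ a ∈ s, Measurable fun Y : Config n =>
      ENNReal.ofReal (w a) * ((‖modeAn L (g a) Ψ Y‖₊ : ℝ≥0∞)) ^ 2 := fun a _ =>
    ((measurable_modeAn (hg a) hΨ).nnnorm.coe_nnreal_ennreal.pow_const 2).const_mul _
  have hmh : ∀ b ∈ t, Measurable fun Y : Config n =>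
      ENNReal.ofReal (w' b) * ((‖modeAn L (h b) Ψ Y‖₊ : ℝ≥0∞)) ^ 2 := fun b _ =>
    ((measurable_modeAn (hh b) hΨ).nnnorm.coe_nnreal_ennreal.pow_const 2).const_mul _
  simp_rw [← lintegral_const_mul' _ _ ENNReal.ofReal_ne_top]
  rw [← lintegral_finsetSum' _ fun a ha => (hmg a ha).aemeasurable,
    ← lintegral_finsetSum' _ fun b hb => (hmh b hb).aemeasurable]
  refine setLIntegral_mono' (measurableSet_cellN n L) (fun Y hY => ?_)
  simp only [Literature.MathematicalPhysics.QuantumManyBody.BoseGas.ennnorm_sq_eq_ofReal]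
  rw [← Finset.sum_congr rfl fun a ha => ENNReal.ofReal_mul (hw a ha),
    ← Finset.sum_congr rfl fun b hb => ENNReal.ofReal_mul (hw' b hb),
    ← ENNReal.ofReal_sum_of_nonneg fun a ha => mul_nonneg (hw a ha) (sq_nonneg _),
    ← ENNReal.ofReal_sum_of_nonneg fun b hb => mul_nonneg (hw' b hb) (sq_nonneg _)]
  exact ENNReal.ofReal_le_ofReal (hpt Y hY)

/-! ## 3. The block indicators `u_B` and block plane waves `f_q` of the route decls (verbatim lambdas) -/

section BlockModes

variable {K : ℕ}

/-- The block `{x | ⌊K x_j / L⌋ = B_j ∀ j}` is measurable. -/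
theorem measurableSet_block (K : ℕ) (L : ℝ) (B : Fin 3 → Fin K) :
    MeasurableSet {x : EuclideanSpace ℝ (Fin 3) | ∀ j : Fin 3, ⌊(K : ℝ) * x j / L⌋ = (((B j : Fin K) : ℕ) : ℤ)} := by
  have hm : ∀ j : Fin 3, Measurable fun x : EuclideanSpace ℝ (Fin 3) => ⌊(K : ℝ) * x j / L⌋ :=
    fun j => Int.measurable_floor.comp (by fun_prop)
  have : {x : EuclideanSpace ℝ (Fin 3) | ∀ j : Fin 3, ⌊(K : ℝ) * x j / L⌋ = (((B j : Fin K) : ℕ) : ℤ)} =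
      ⋂ j : Fin 3, (fun x : EuclideanSpace ℝ (Fin 3) => ⌊(K : ℝ) * x j / L⌋) ⁻¹' {(((B j : Fin K) : ℕ) : ℤ)} := by
    ext x; simp
  rw [this]
  exact MeasurableSet.iInter fun j => (measurableSet_singleton _).preimage (hm j)

/-- The normalised block indicator `u_B` is measurable. -/
theorem measurable_blockMode (K : ℕ) (L : ℝ) (B : Fin 3 → Fin K) :
    Measurable (fun x : EuclideanSpace ℝ (Fin 3) => if (∀ j : Fin 3, ⌊(K : ℝ) * x j / L⌋ = (((B j : Fin K) : ℕ) : ℤ)) then ((((Real.sqrt ((L / (K : ℝ)) ^ 3))⁻¹ : ℝ) : ℂ)) else 0) :=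
  Measurable.ite (measurableSet_block K L B) measurable_const measurable_const

/-- `u_B` is bounded by its height. -/
theorem norm_blockMode_le (K : ℕ) (L : ℝ) (B : Fin 3 → Fin K) (x : EuclideanSpace ℝ (Fin 3)) :
    ‖(fun x : EuclideanSpace ℝ (Fin 3) => if (∀ j : Fin 3, ⌊(K : ℝ) * x j / L⌋ = (((B j : Fin K) : ℕ) : ℤ)) then ((((Real.sqrt ((L / (K : ℝ)) ^ 3))⁻¹ : ℝ) : ℂ)) else 0) x‖ ≤ ‖((((Real.sqrt ((L / (K : ℝ)) ^ 3))⁻¹ : ℝ) : ℂ))‖ := by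
  dsimp only
  split_ifs
  · exact le_rfl
  · rw [norm_zero]; exact norm_nonneg _

/-- The block plane wave `f_q` is measurable. -/
theorem measurable_blockWave (K : ℕ) (L : ℝ) (q : Fin 3 → Fin K) :
    Measurable (fun x : EuclideanSpace ℝ (Fin 3) => (((Real.sqrt (L ^ 3))⁻¹ : ℝ) : ℂ) * Complex.exp (((2 * Real.pi * (∑ j : Fin 3, ((q j : ℕ) : ℝ) * (⌊(K : ℝ) * x j / L⌋ : ℝ)) / (K : ℝ) : ℝ) : ℂ) * Complex.I)) := by
  have hm : ∀ j : Fin 3, Measurable fun x : EuclideanSpace ℝ (Fin 3) => (⌊(K : ℝ) * x j / L⌋ : ℝ) :=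
    fun j => (measurable_from_top (f := fun z : ℤ => (z : ℝ))).comp
      (Int.measurable_floor.comp (by fun_prop))
  have hs : Measurable fun x : EuclideanSpace ℝ (Fin 3) =>
      (2 * Real.pi * (∑ j : Fin 3, ((q j : ℕ) : ℝ) * (⌊(K : ℝ) * x j / L⌋ : ℝ)) / (K : ℝ) : ℝ) :=
    ((Finset.measurable_sum _ fun j _ => (hm j).const_mul _).const_mul _).div_const _
  exact ((Complex.measurable_ofReal.comp hs).mul_const Complex.I).cexp.const_mul _

/-- `f_q` is bounded by its height. -/
theorem norm_blockWave_le (K : ℕ) (L : ℝ) (q : Fin 3 → Fin K) (x : EuclideanSpace ℝ (Fin 3)) :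
    ‖(fun x : EuclideanSpace ℝ (Fin 3) => (((Real.sqrt (L ^ 3))⁻¹ : ℝ) : ℂ) * Complex.exp (((2 * Real.pi * (∑ j : Fin 3, ((q j : ℕ) : ℝ) * (⌊(K : ℝ) * x j / L⌋ : ℝ)) / (K : ℝ) : ℝ) : ℂ) * Complex.I)) x‖ ≤ ‖(((Real.sqrt (L ^ 3))⁻¹ : ℝ) : ℂ)‖ := by
  dsimp only
  rw [norm_mul, Complex.norm_exp_ofReal_mul_I, mul_one]

/-- Block index of a point of the cell: `0 ≤ ⌊K x_j / L⌋ < K`. -/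
theorem floor_block_index (hK : 0 < K) (hL : 0 < L) {x : EuclideanSpace ℝ (Fin 3)} (hx : x ∈ cell L)
    (j : Fin 3) : 0 ≤ ⌊(K : ℝ) * x j / L⌋ ∧ ⌊(K : ℝ) * x j / L⌋ < (K : ℤ) := by
  have h0 : 0 ≤ x j := (hx j).1
  have h1 : x j < L := (hx j).2
  refine ⟨Int.floor_nonneg.2 (div_nonneg (mul_nonneg (Nat.cast_nonneg _) h0) hL.le), ?_⟩
  rw [Int.floor_lt, div_lt_iff₀ hL]
  push_cast
  exact mul_lt_mul_of_pos_left h1 (Nat.cast_pos.2 hK)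

/-- CELL EXPANSION: on the cell, `f_q = Σ_B K^(-3/2) χ_q(B) u_B`. -/
theorem blockWave_eq_sum_on_cell (hK : 0 < K) (hL : 0 < L) (q : Fin 3 → Fin K)
    {x : EuclideanSpace ℝ (Fin 3)} (hx : x ∈ cell L) :
    (fun x : EuclideanSpace ℝ (Fin 3) => (((Real.sqrt (L ^ 3))⁻¹ : ℝ) : ℂ) * Complex.exp (((2 * Real.pi * (∑ j : Fin 3, ((q j : ℕ) : ℝ) * (⌊(K : ℝ) * x j / L⌋ : ℝ)) / (K : ℝ) : ℝ) : ℂ) * Complex.I)) x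
      = ∑ B : Fin 3 → Fin K, (Complex.exp (((2 * Real.pi * (∑ j : Fin 3, ((q j : ℕ) : ℝ) * ((B j : ℕ) : ℝ)) / (K : ℝ) : ℝ) : ℂ) * Complex.I) / ((Real.sqrt ((K : ℝ) ^ 3) : ℝ) : ℂ)) * (fun x : EuclideanSpace ℝ (Fin 3) => if (∀ j : Fin 3, ⌊(K : ℝ) * x j / L⌋ = (((B j : Fin K) : ℕ) : ℤ)) then ((((Real.sqrt ((L / (K : ℝ)) ^ 3))⁻¹ : ℝ) : ℂ)) else 0) x := by
  have hb := fun j => floor_block_index hK hL hx j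
  set B₀ : Fin 3 → Fin K := fun j => ⟨(⌊(K : ℝ) * x j / L⌋).toNat, by have := hb j; omega⟩ with hB₀
  have hB₀cast : ∀ j, (((B₀ j : Fin K) : ℕ) : ℤ) = ⌊(K : ℝ) * x j / L⌋ := fun j => by
    simp only [hB₀]; exact Int.toNat_of_nonneg (hb j).1
  rw [Finset.sum_eq_single B₀]
  · have hif : ∀ j : Fin 3, ⌊(K : ℝ) * x j / L⌋ = (((B₀ j : Fin K) : ℕ) : ℤ) := fun j => (hB₀cast j).symm
    dsimp only
    rw [if_pos hif]
    have hreal : ∀ j : Fin 3, (⌊(K : ℝ) * x j / L⌋ : ℝ) = (((B₀ j : Fin K) : ℕ) : ℝ) := fun j => by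
      rw [← hB₀cast j]; push_cast; rfl
    simp_rw [hreal]
    have hKr : (0 : ℝ) < K := Nat.cast_pos.2 hK
    have hs : Real.sqrt (L ^ 3) = Real.sqrt ((K : ℝ) ^ 3) * Real.sqrt ((L / (K : ℝ)) ^ 3) := by
      rw [← Real.sqrt_mul (by positivity)]
      congr 1
      field_simp
    have h1 : (Real.sqrt ((K : ℝ) ^ 3) : ℂ) ≠ 0 :=
      Complex.ofReal_ne_zero.2 (Real.sqrt_pos.2 (by positivity)).ne'
    have h2 : (Real.sqrt ((L / (K : ℝ)) ^ 3) : ℂ) ≠ 0 :=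
      Complex.ofReal_ne_zero.2 (Real.sqrt_pos.2 (by positivity)).ne'
    rw [hs]
    push_cast
    field_simp
  · intro B _ hB
    dsimp only
    rw [if_neg, mul_zero]
    intro hall
    apply hB
    funext j
    apply Fin.ext
    have h1 := hall j
    have h2 := hB₀cast j
    omega
  · intro h; exact absurd (Finset.mem_univ B₀) h

/-- `a(φ)` only sees the mode on the cell. -/
theorem modeAn_congr_on_cell {φ φ' : Space → ℂ} (h : ∀ x ∈ cell L, φ x = φ' x)
    (Ψ : Config (n + 1) → ℂ) (Y : Config n) : modeAn L φ Ψ Y = modeAn L φ' Ψ Y := by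
  simp only [modeAn_apply]
  congr 1
  exact setIntegral_congr_fun (measurableSet_cell L) fun x hx => by rw [h x hx]

/-- The slice amplitude of a block plane wave: `a(f_q)Ψ(Y) = K^(-3/2) Σ_B conj(χ_q(B)) a(u_B)Ψ(Y)`. -/
theorem modeAn_blockWave (hK : 0 < K) (hL : 0 < L) (q : Fin 3 → Fin K)
    {Ψ : Config (n + 1) → ℂ} (hΨ : Continuous Ψ) (Y : Config n) :
    modeAn L (fun x : EuclideanSpace ℝ (Fin 3) => (((Real.sqrt (L ^ 3))⁻¹ : ℝ) : ℂ) * Complex.exp (((2 * Real.pi * (∑ j : Fin 3, ((q j : ℕ) : ℝ) * (⌊(K : ℝ) * x j / L⌋ : ℝ)) / (K : ℝ) : ℝ) : ℂ) * Complex.I)) Ψ Y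
      = ∑ B : Fin 3 → Fin K, conj (Complex.exp (((2 * Real.pi * (∑ j : Fin 3, ((q j : ℕ) : ℝ) * ((B j : ℕ) : ℝ)) / (K : ℝ) : ℝ) : ℂ) * Complex.I) / ((Real.sqrt ((K : ℝ) ^ 3) : ℝ) : ℂ)) * modeAn L (fun x : EuclideanSpace ℝ (Fin 3) => if (∀ j : Fin 3, ⌊(K : ℝ) * x j / L⌋ = (((B j : Fin K) : ℕ) : ℤ)) then ((((Real.sqrt ((L / (K : ℝ)) ^ 3))⁻¹ : ℝ) : ℂ)) else 0) Ψ Y := by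
  rw [modeAn_congr_on_cell (fun x hx => blockWave_eq_sum_on_cell hK hL q hx) Ψ Y]
  exact modeAn_finset_sum_mode Finset.univ _ _ (fun B => measurable_blockMode K L B)
    (fun B => ⟨_, norm_blockMode_le K L B⟩) hΨ Y

/-- GRAM FORM of the block-wave occupation:
`n(f_q) = ∫_(cellⁿ) |K^(-3/2) Σ_B conj(χ_q(B)) a(u_B)Ψ(Y)|² dY`. -/
theorem cellOccupation_blockWave_eq (hK : 0 < K) (hL : 0 < L) (q : Fin 3 → Fin K)
    {Ψ : Config (n + 1) → ℂ} (hΨ : Continuous Ψ) :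
    cellOccupation (n + 1) L (fun x : EuclideanSpace ℝ (Fin 3) => (((Real.sqrt (L ^ 3))⁻¹ : ℝ) : ℂ) * Complex.exp (((2 * Real.pi * (∑ j : Fin 3, ((q j : ℕ) : ℝ) * (⌊(K : ℝ) * x j / L⌋ : ℝ)) / (K : ℝ) : ℝ) : ℂ) * Complex.I)) Ψ
      = ∫⁻ Y in cellN n L, (‖∑ B : Fin 3 → Fin K, conj (Complex.exp (((2 * Real.pi * (∑ j : Fin 3, ((q j : ℕ) : ℝ) * ((B j : ℕ) : ℝ)) / (K : ℝ) : ℝ) : ℂ) * Complex.I) / ((Real.sqrt ((K : ℝ) ^ 3) : ℝ) : ℂ)) *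
          modeAn L (fun x : EuclideanSpace ℝ (Fin 3) => if (∀ j : Fin 3, ⌊(K : ℝ) * x j / L⌋ = (((B j : Fin K) : ℕ) : ℤ)) then ((((Real.sqrt ((L / (K : ℝ)) ^ 3))⁻¹ : ℝ) : ℂ)) else 0) Ψ Y‖₊ : ℝ≥0∞) ^ 2 := by
  rw [cellOccupation_eq_lintegral_modeAn]
  refine lintegral_congr fun Y => ?_
  rw [modeAn_blockWave hK hL q hΨ Y]

/-- PARSEVAL on the block span: `Σ_q n(f_q) = Σ_B n(u_B)`, from the finite Plancherel identity on
`(ℤ/K)³` supplied as the hypothesis `hPl` (proved in the route's engine). -/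
theorem parseval_blockWaves (hK : 0 < K) (hL : 0 < L)
    (hPl : ∀ m : (Fin 3 → Fin K) → ℂ,
      ∑ q : Fin 3 → Fin K, ‖∑ B : Fin 3 → Fin K, conj (Complex.exp (((2 * Real.pi * (∑ j : Fin 3, ((q j : ℕ) : ℝ) * ((B j : ℕ) : ℝ)) / (K : ℝ) : ℝ) : ℂ) * Complex.I)) * m B‖ ^ 2
        = (K : ℝ) ^ 3 * ∑ B : Fin 3 → Fin K, ‖m B‖ ^ 2)
    {Ψ : Config (n + 1) → ℂ} (hΨ : Continuous Ψ) :
    ∑ q : Fin 3 → Fin K, cellOccupation (n + 1) L (fun x : EuclideanSpace ℝ (Fin 3) => (((Real.sqrt (L ^ 3))⁻¹ : ℝ) : ℂ) * Complex.exp (((2 * Real.pi * (∑ j : Fin 3, ((q j : ℕ) : ℝ) * (⌊(K : ℝ) * x j / L⌋ : ℝ)) / (K : ℝ) : ℝ) : ℂ) * Complex.I)) Ψ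
      = ∑ B : Fin 3 → Fin K, cellOccupation (n + 1) L (fun x : EuclideanSpace ℝ (Fin 3) => if (∀ j : Fin 3, ⌊(K : ℝ) * x j / L⌋ = (((B j : Fin K) : ℕ) : ℤ)) then ((((Real.sqrt ((L / (K : ℝ)) ^ 3))⁻¹ : ℝ) : ℂ)) else 0) Ψ := by
  have hKr : (0 : ℝ) < K := Nat.cast_pos.2 hK
  have hK3 : (0 : ℝ) < (K : ℝ) ^ 3 := by positivity
  have h := cellOccupation_transfer_eq (L := L) Finset.univ Finset.univ (fun _ => (1 : ℝ)) (fun _ => (1 : ℝ))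
    (fun _ _ => zero_le_one) (fun _ _ => zero_le_one)
    (fun q : Fin 3 → Fin K => (fun x : EuclideanSpace ℝ (Fin 3) => (((Real.sqrt (L ^ 3))⁻¹ : ℝ) : ℂ) * Complex.exp (((2 * Real.pi * (∑ j : Fin 3, ((q j : ℕ) : ℝ) * (⌊(K : ℝ) * x j / L⌋ : ℝ)) / (K : ℝ) : ℝ) : ℂ) * Complex.I)))
    (fun B : Fin 3 → Fin K => (fun x : EuclideanSpace ℝ (Fin 3) => if (∀ j : Fin 3, ⌊(K : ℝ) * x j / L⌋ = (((B j : Fin K) : ℕ) : ℤ)) then ((((Real.sqrt ((L / (K : ℝ)) ^ 3))⁻¹ : ℝ) : ℂ)) else 0))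
    (fun q => measurable_blockWave K L q) (fun B => measurable_blockMode K L B) hΨ ?_
  · simpa using h
  intro Y _
  simp only [one_mul]
  simp_rw [modeAn_blockWave hK hL _ hΨ Y]
  have hconj : ∀ (q B : Fin 3 → Fin K), conj (Complex.exp (((2 * Real.pi * (∑ j : Fin 3, ((q j : ℕ) : ℝ) * ((B j : ℕ) : ℝ)) / (K : ℝ) : ℝ) : ℂ) * Complex.I) / ((Real.sqrt ((K : ℝ) ^ 3) : ℝ) : ℂ))
      = conj (Complex.exp (((2 * Real.pi * (∑ j : Fin 3, ((q j : ℕ) : ℝ) * ((B j : ℕ) : ℝ)) / (K : ℝ) : ℝ) : ℂ) * Complex.I)) / ((Real.sqrt ((K : ℝ) ^ 3) : ℝ) : ℂ) := fun q B => by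
    rw [map_div₀, Complex.conj_ofReal]
  simp_rw [hconj, div_mul_eq_mul_div, ← Finset.sum_div, norm_div, div_pow]
  have hn : ‖((Real.sqrt ((K : ℝ) ^ 3) : ℝ) : ℂ)‖ ^ 2 = (K : ℝ) ^ 3 := by
    rw [Complex.norm_real, Real.norm_of_nonneg (Real.sqrt_nonneg _), Real.sq_sqrt hK3.le]
  rw [hn, ← Finset.sum_div, hPl]
  field_simp

/-! ## 4. Parseval, unconditionally (finite Plancherel from `BlockLatticeFSumPlancherel`) -/

/-- PARSEVAL on the block span, unconditional: `Σ_q n(f_q) = Σ_B n(u_B)` for continuous `Ψ`. -/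
theorem parseval_blockWaves' (hK : 0 < K) (hL : 0 < L) {Ψ : Config (n + 1) → ℂ} (hΨ : Continuous Ψ) :
    ∑ q : Fin 3 → Fin K, cellOccupation (n + 1) L (fun x : EuclideanSpace ℝ (Fin 3) => (((Real.sqrt (L ^ 3))⁻¹ : ℝ) : ℂ) * Complex.exp (((2 * Real.pi * (∑ j : Fin 3, ((q j : ℕ) : ℝ) * (⌊(K : ℝ) * x j / L⌋ : ℝ)) / (K : ℝ) : ℝ) : ℂ) * Complex.I)) Ψ
      = ∑ B : Fin 3 → Fin K, cellOccupation (n + 1) L (fun x : EuclideanSpace ℝ (Fin 3) => if (∀ j : Fin 3, ⌊(K : ℝ) * x j / L⌋ = (((B j : Fin K) : ℕ) : ℤ)) then ((((Real.sqrt ((L / (K : ℝ)) ^ 3))⁻¹ : ℝ) : ℂ)) else 0) Ψ :=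
  parseval_blockWaves hK hL (fun m => Plancherel.plancherel hK m) hΨ

/-- PARSEVAL for a periodic trial state with `N ≥ 1` particles (the form used by `ShellModeCounting`:
`Ψ : PeriodicTrialState N L`, occupations of `Ψ.ψ`). -/
theorem parseval_blockWaves_trialState {N : ℕ} (hN : 0 < N) (hK : 0 < K) (hL : 0 < L)
    (Ψ : PeriodicTrialState N L) :
    ∑ q : Fin 3 → Fin K, cellOccupation N L (fun x : EuclideanSpace ℝ (Fin 3) => (((Real.sqrt (L ^ 3))⁻¹ : ℝ) : ℂ) * Complex.exp (((2 * Real.pi * (∑ j : Fin 3, ((q j : ℕ) : ℝ) * (⌊(K : ℝ) * x j / L⌋ : ℝ)) / (K : ℝ) : ℝ) : ℂ) * Complex.I)) Ψ.ψ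
      = ∑ B : Fin 3 → Fin K, cellOccupation N L (fun x : EuclideanSpace ℝ (Fin 3) => if (∀ j : Fin 3, ⌊(K : ℝ) * x j / L⌋ = (((B j : Fin K) : ℕ) : ℤ)) then ((((Real.sqrt ((L / (K : ℝ)) ^ 3))⁻¹ : ℝ) : ℂ)) else 0) Ψ.ψ := by
  obtain ⟨n, rfl⟩ := Nat.exists_eq_succ_of_ne_zero hN.ne'
  exact parseval_blockWaves' hK hL Ψ.contDiff.continuous

end BlockModes

end Summit.AtomisticToContinuum.BoseEinsteinCondensation.Theses.BlockLatticeFSum.Kinematics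

end
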